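import Literature.AlgebraicGeometry.Resolution.ValueGroupRankBound
import Literature.AlgebraicGeometry.Resolution.ValueGroupRank
import HarnessLib

/-!
# The choice (46): `f₁, …, f_r ∈ S` whose values form a "basis of `V K ⊗ ℚ`", `1 ≤ r ≤ 3`

Topic: `Literature/AlgebraicGeometry/Resolution`. PROOF side of `CossartPiltant2019ReductionP`
(`ArithmeticalThreefoldsLocal.lean`), input (C4), [CoP1] Prop. 8.1 / Prop. 9.3 (V. Cossart,
O. Piltant, HAL hal-00139124, p. 22: "rational rank `r` (`1 ≤ r ≤ 3`)", "We pick elements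
`f₁, …, f_r` … such that `W f₁, …, W f_r` are linearly independent in `W L ⊗_ℤ ℚ`"; p. 27:
"pick `f₁, …, f_r ∈ R₁` such that `(V f₁, …, V f_r)` form a basis of `V K ⊗_ℤ ℚ`"). In the
frame of the chain this file PROVES the existence of the data consumed by
`head_conclusion_of_principalized` (`Prop81MiddleAssembly.lean`): `0 < r ≤ 3` and nonzero
`s₁, …, s_r ∈ S` with multiplicatively independent values such that the value of every nonzero
element of `E` is rationally dependent on them (`exists_rank_data`), whence the relation
supplier `hdep` (`exists_relation_of_spanning`). Assembled from
`exists_maximal_independent_family`, `card_le_three_of_independent` (hypothesis `hEmb`) and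
`exists_dependence_of_isAlgebraic`.

Everything is PROVED; no named facts, definitions, instances or notation are introduced.

## Sources

* V. Cossart, O. Piltant, J. Algebra 320 (2008) 1051–1082: proofs of Prop. 8.1 and 9.3
  (HAL hal-00139124, pp. 22, 27). [CossartPiltant2008]
-/

noncomputable section

open AlgebraicGeometry CategoryTheory

namespace Literature.AlgebraicGeometry.Resolution

universe u

open IsLocalRing _root_.Polynomial Function

section RankData

variable {S : Type u} [CommRing S] [IsRegularLocalRing S] {E : Type u} [Field E] [Algebra S E]
  [Algebra.IsAlgebraic S E]

set_option maxHeartbeats 800000 in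
/-- **The choice (46) in the frame** ([CoP1] pp. 22, 27): there are `0 < r ≤ 3` nonzero
elements `s₁, …, s_r ∈ S` with multiplicatively independent values on which the value of every
nonzero element of `E` depends rationally; in particular (`hdep`) any family of more than `r`
nonzero elements of `E` satisfies a non-trivial multiplicative relation of values.
[cite: CossartPiltant2008, proofs of Prop. 8.1 and 9.3 (HAL pp. 22, 27)] -/
theorem exists_rank_data
    (hEmb : ∀ (Z : Scheme.{u}) [IsIntegral Z] [IsNoetherian Z], Scheme.IsRegular Z →
      Scheme.IsExcellent Z → ∀ (X : Set Z), IsClosed X → X ≠ Set.univ → topologicalKrullDim X ≤ 2 →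
        ∃ (Z' : Scheme.{u}) (π : Z' ⟶ Z), IsProper π ∧ Function.Surjective π.base ∧
          (∃ U : Z.Opens, (U : Set Z) = Xᶜ ∧ IsIso (π ∣_ U)) ∧
          IsStrictNormalCrossingsDivisor Z' (π.base ⁻¹' X))
    (hexc : IsExcellentRing S) (hSdim : ringKrullDim S = 3)
    (hinj : Function.Injective (algebraMap S E))
    (OE : ValuationSubring E) (hSO : ∀ s : S, algebraMap S E s ∈ OE)
    (hdom : ∀ s ∈ maximalIdeal S, OE.valuation (algebraMap S E s) < 1)
    (hres : ∀ y : OE, ∃ q : S[X], (∃ i, q.coeff i ∉ maximalIdeal S) ∧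
      OE.valuation (q.eval₂ (algebraMap S E) y) < 1) :
    ∃ (r : ℕ) (s : Fin r → S), 0 < r ∧ r ≤ 3 ∧ (∀ i, s i ≠ 0) ∧
      (∀ p m : Fin r → ℕ, ∏ i, OE.valuation (algebraMap S E (s i)) ^ p i =
        ∏ i, OE.valuation (algebraMap S E (s i)) ^ m i → p = m) ∧
      (∀ y : E, y ≠ 0 → ∃ (n : ℕ) (a b : Fin r → ℕ), 0 < n ∧
        OE.valuation y ^ n * ∏ i, OE.valuation (algebraMap S E (s i)) ^ b i =
          ∏ i, OE.valuation (algebraMap S E (s i)) ^ a i) ∧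
      (∀ (d : ℕ) (I : Finset (Fin d)) (y : Fin d → E), r < I.card → (∀ k, y k ≠ 0) →
        ∃ c : Fin d → ℤ, (∀ k, k ∉ I → c k = 0) ∧ c ≠ 0 ∧
          ∏ k, OE.valuation (y k) ^ (c k).toNat = ∏ k, OE.valuation (y k) ^ (-c k).toNat) := by
  classical
  haveI : IsDomain S := isDomain_of_isRegularLocalRing S
  -- an element of `S` of value in `(0, 1)`: `𝔪_S ≠ 0` since `dim S = 3`
  have hm : ∃ s ∈ maximalIdeal S, s ≠ 0 := by
    by_contra h
    push Not at h
    have hbot : maximalIdeal S = ⊥ := le_bot_iff.mp fun s hs => h s hs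
    have hF : IsField S := (IsLocalRing.isField_iff_maximalIdeal_eq).mpr hbot
    have := ringKrullDim_eq_zero_of_isField hF
    rw [hSdim] at this
    exact absurd this (by decide)
  obtain ⟨s₀, hs₀m, hs₀0⟩ := hm
  -- the maximal independent family inside the image of `S`
  obtain ⟨r, g, hr0, hr3, hgB, hg0, hgind, hgmax⟩ :=
    exists_maximal_independent_family OE (Set.range (algebraMap S E)) 3
      (fun k y hyB hy0 hyind => by
        choose s' hs' using fun i => hyB i
        have hs'0 : ∀ i, s' i ≠ 0 := fun i h0 => hy0 i (by rw [← hs' i, h0, map_zero])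
        refine card_le_three_of_independent hEmb hexc hSdim hinj OE hSO hdom hres k s' hs'0 ?_
        intro p m hpm
        refine hyind p m ?_
        simpa only [hs'] using hpm)
      ⟨algebraMap S E s₀, ⟨s₀, rfl⟩, fun h0 => hs₀0 (hinj (by rw [h0, map_zero])),
        hdom s₀ hs₀m⟩
  choose s hs using fun i => hgB i
  have hs0 : ∀ i, s i ≠ 0 := fun i h0 => hg0 i (by rw [← hs i, h0, map_zero])
  have hgs : ∀ i, OE.valuation (algebraMap S E (s i)) = OE.valuation (g i) := fun i => by
    rw [hs i]
  -- every nonzero element of `E` depends on them (`E` algebraic over `S`)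
  have hspan : ∀ y : E, y ≠ 0 → ∃ (n : ℕ) (a b : Fin r → ℕ), 0 < n ∧
      OE.valuation y ^ n * ∏ i, OE.valuation (g i) ^ b i = ∏ i, OE.valuation (g i) ^ a i :=
    fun y hy0 => exists_dependence_of_isAlgebraic OE hinj g
      (fun s' hs' => hgmax _ ⟨s', rfl⟩ hs') y hy0 (Algebra.IsAlgebraic.isAlgebraic y)
  refine ⟨r, s, hr0, hr3, hs0, fun p m hpm => hgind p m (by simpa only [hgs] using hpm),
    fun y hy0 => by simpa only [hgs] using hspan y hy0, fun d I y hI hy => ?_⟩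
  exact exists_relation_of_spanning OE g hg0 hspan I y hI hy

end RankData

end Literature.AlgebraicGeometry.Resolution

end
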